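import Summits.QuantumFields.YangMills.Theorems.BalabanLadderROTTiltSplitConverse
import Summits.QuantumFields.YangMills.Theorems.BalabanLadderROTRevisions
import HarnessLib

/-!
# Crux `ROT` (stmt-QuantumFields-20042): the tilt split is a TRIANGLE — any two of {N-ROT.3, TI, KING on the class} give the third

Helper file of the fleet lead `ym-spine-20042-p1` (generation g5), `--supports stmt-QuantumFields-20042` (count-neutral).

The exact one-step identity `kingDefect_eq_brackets` (`Theorems/BalabanLadderROTTiltSplit.lean`, p469977) reads
`KING_k(F) = B1_k(R·F) + B2_k(F)` for every test function `F`, where `KING_k` is King's finite-angle defect of the axis lattice on the straight torus,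
`B1_k` the regularisation bracket (axis vs tilted lattice on one torus) and `B2_k` the tilt bracket (axis lattice on the tilted vs the straight torus).
King's class is stable under `R^{±1}`, so along a scheme any two of the three limits `→ 0` on the class give the third:

* `latticeKingWardOn_of_tilt` (p469977): `TiltedRegComparisonOn ∧ TiltInsensitivityOn ⇒ LatticeKingWardOn {θ}`;
* `tiltedRegComparisonOn_of_latticeKingWardOn` (p485327): `TiltInsensitivityOn ∧ LatticeKingWardOn {θ} ⇒ TiltedRegComparisonOn`;
* HERE `tiltInsensitivityOn_of_tiltedRegComparisonOn_of_latticeKingWardOn`: `TiltedRegComparisonOn ∧ LatticeKingWardOn {θ} ⇒ TiltInsensitivityOn`,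
  and `tiltInsensitivityOn_iff_latticeKingWardOn` (under N-ROT.3).

Guarded `∀ G` forms at King's data (`(4,3,5)`, `θ = arcsin (3/5)`, `S₅ = fittedClass 5`): `ti_of_nrot3_of_kingSingleIROn : NROT3(S₅) → KingSingleIROn S₅ → TI(S₅)` and
**`kingSingleIROn_iff_ti_of_nrot3 : NROT3(S₅) → (KingSingleIROn S₅ ↔ TI(S₅))`**.

READING for the registry (owner's [R4] choice at T-0): modulo the leg-1 content `NROT3(S₅)`, the v6 stub of record (`KingLimitIROn S₅ ↔ KingSingleIROn S₅`,
`kingLimitIROn_iff_kingSingleIROn`) and the split's infrared stub `TI(S₅)` are EQUIVALENT; the split «v7 = NROT3 + TI» is exactly «v6 + NROT3 made explicit»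
(`v7 ⇒ v6`: `kingLimitIROn_five_of_tilt345`; `v6 ∧ NROT3 ⇒ v7`: this file).  Neither registry choice hides or adds infrared content beyond naming it.
No definition, no sorry.
-/

set_option autoImplicit false

noncomputable section

open scoped SchwartzMap
open MeasureTheory Filter Topology
open Literature.MathematicalPhysics.QuantumFieldTheory Literature.MathematicalPhysics.QuantumLattice
open Literature.MathematicalPhysics.AQFT
open Summit.QuantumFields.YangMills.Cruxes.OSLegsFromFemtoAndGap.DlrCollarTransfer
open Summit.QuantumFields.YangMills.Cruxes.OSLegsAtWeakCouplingC.Sketch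
open Summit.QuantumFields.YangMills.Cruxes.OSLegsAtWeakCouplingC.Y2Bridge
open Summit.QuantumFields.YangMills.Theorems.OSLegsFromFemtoAndGap (latticeDist)
open Summit.QuantumFields.YangMills.Theorems.NPointIsotropy.Negative (E4)

namespace Summit.QuantumFields.YangMills.Theorems.ROT

section Triangle

variable {G : Type} [Group G] [TopologicalSpace G] [IsTopologicalGroup G] [CompactSpace G]
  [MeasurableSpace G] [BorelSpace G]

/-- **`TiltedRegComparisonOn ∧ LatticeKingWardOn {θ} ⇒ TiltInsensitivityOn`** (third side of the triangle): the tilt bracket at `F` is King's defect at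
`F` minus the regularisation bracket at `R·F` (`kingDefect_eq_brackets`), and King's class is stable under `R`. -/
theorem tiltInsensitivityOn_of_tiltedRegComparisonOn_of_latticeKingWardOn (r : LatticeRep G) (a : ℝ → ℝ) (C : ℕ → PeriodCell 4) (θ : ℝ)
    (S : Set ℕ) (hRC : TiltedRegComparisonOn G r a C θ S) (hK : LatticeKingWardOn G r a ({θ} : Set ℝ) S) :
    TiltInsensitivityOn G r a C S := by
  intro sch hS hunits hβ hranges
  obtain ⟨r₁, hr₁, h1⟩ := hRC sch hS hunits hβ hranges
  obtain ⟨r₂, hr₂, h2⟩ := hK sch hS hunits hβ hranges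
  refine ⟨min r₁ r₂, lt_min hr₁ hr₂, fun n hn F hF => ?_⟩
  have hF₁ : F ∈ King.KingClass n r₁ := kingClass_mono (min_le_left _ _) hF
  have hF₂ : F ∈ King.KingClass n r₂ := kingClass_mono (min_le_right _ _) hF
  have t1 := h1 n hn _ (King.linActMulti_mem_kingClass hF₁ (planeRot (0 : Fin 3) θ))
  have t2 := h2 n hn F hF₂ θ (Set.mem_singleton θ)
  have t21 := t2.sub t1
  rw [sub_zero] at t21
  refine t21.congr fun k => ?_
  have e := kingDefect_eq_brackets (C (sch.L k)) r (sch.β k) (sch.L k) (sch.a k) θ F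
  linear_combination e

/-- **Given the regularisation bracket (N-ROT.3), the tilt bracket and King's single-angle lattice Ward statement on the class are EQUIVALENT.** -/
theorem tiltInsensitivityOn_iff_latticeKingWardOn (r : LatticeRep G) (a : ℝ → ℝ) (C : ℕ → PeriodCell 4) (θ : ℝ) (S : Set ℕ)
    (hRC : TiltedRegComparisonOn G r a C θ S) :
    TiltInsensitivityOn G r a C S ↔ LatticeKingWardOn G r a ({θ} : Set ℝ) S :=
  ⟨fun hTI => latticeKingWardOn_of_tilt r a C θ S hRC hTI,
    tiltInsensitivityOn_of_tiltedRegComparisonOn_of_latticeKingWardOn r a C θ S hRC⟩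

end Triangle

/-! ## Guarded forms at King's data -/

open PythTriple

/-- **`TI(S₅) ⇐ N-ROT.3(S₅) ∧ KingSingleIROn S₅`**: behind the common guard block (`a > 0`, `a → 0`, `MomentBounds6`, `GapInUnits`), the leg-1 content and
King's single-angle lattice Ward statement on the fitted class of `5` give the tilt bracket. -/
theorem ti_of_nrot3_of_kingSingleIROn (h3 : NROT3 king345.tiltCell (Real.arcsin (3 / 5)) (fittedClass 5))
    (hK : KingSingleIROn (fittedClass 5)) : TI king345.tiltCell (fittedClass 5) := by
  intro G _ _ _ _ hG
  letI : MeasurableSpace G := borel G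
  haveI : BorelSpace G := ⟨rfl⟩
  intro r a ha ha0 hUV hIR
  exact tiltInsensitivityOn_of_tiltedRegComparisonOn_of_latticeKingWardOn r a _ _ _ (h3 G hG r a ha ha0 hUV hIR)
    (hK G hG r a ha ha0 hUV hIR)

/-- **Modulo N-ROT.3 on King's class, the v6 stub content (`KingSingleIROn S₅`, equivalently `KingLimitIROn S₅`) and the split's infrared stub `TI(S₅)` are
EQUIVALENT** — the registry reading: «v7 = NROT3 + TI» is «v6 + NROT3 made explicit», nothing more, nothing less. -/
theorem kingSingleIROn_iff_ti_of_nrot3 (h3 : NROT3 king345.tiltCell (Real.arcsin (3 / 5)) (fittedClass 5)) :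
    KingSingleIROn (fittedClass 5) ↔ TI king345.tiltCell (fittedClass 5) :=
  ⟨ti_of_nrot3_of_kingSingleIROn h3, kingSingleIROn_of_tilt king345.tiltCell h3⟩

/-- The same with the limit-point form of the v6 stub (`KingLimitIROn {L | 5 ∣ 2L+1}`, the registered-candidate text). -/
theorem kingLimitIROn_five_iff_ti_of_nrot3 (h3 : NROT3 king345.tiltCell (Real.arcsin (3 / 5)) (fittedClass 5)) :
    KingLimitIROn {L : ℕ | 5 ∣ 2 * L + 1} ↔ TI king345.tiltCell (fittedClass 5) :=
  kingLimitIROn_iff_kingSingleIROn.trans (kingSingleIROn_iff_ti_of_nrot3 h3)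

end Summit.QuantumFields.YangMills.Theorems.ROT

end
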